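import Literature.AlgebraicGeometry.HodgeTheory.AbelianVarietySimpleSubvarietiesCount
import HarnessLib

/-!
# Abelian subvarieties of a given dimension in a multiplicity-free abelian variety: as many as subsets `T` of the components with
# `Σ_{t ∈ T} dim Y_t = d`; a product of `r` pairwise non-isogenous elliptic curves has exactly `r.choose d` of dimension `d`
# (Mumford §19 Cor. 1–2; Zarhin 2008 Thm. 3.2; Lange–Rodríguez §2.9)

Layer `Literature/AlgebraicGeometry/HodgeTheory`; theorems only (no `def`, no instance, no named fact; net debt 0).  For a
multiplicity-free `X` over a perfect field — a `Hom`-orthogonal system of SIMPLE abelian subvarieties `i_q : Y_q ↪ X` of positive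
dimension whose addition map `⨁ Y_q → X` is an isogeny — the closed subsets underlying abelian subvarieties are exactly the `2^{#Q}`
partial sums `Σ_{t ∈ T} Y_t` (`HodgeTheory/AbelianVarietyMultiplicityFreeSubvarieties`), and an abelian subvariety with the closed subset
of `Σ_{t ∈ T} Y_t` has dimension `Σ_{t ∈ T} dim Y_t` (`…SimpleSubvarietiesCount.dim_eq_sum_of_range_eq_range_biproduct_desc`).  Hence the
abelian subvarieties OF DIMENSION `d` correspond to the subsets `T ⊆ Q` with `Σ_{t ∈ T} dim Y_t = d`; when every component is an
elliptic curve (`dim Y_q = 1`) there are `(#Q).choose d` of them.  The decomposition-free forms start from `X ∼ ⨁_q B_q`.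

THE PRINT.  Mumford, *Abelian Varieties* (1970) §19 Cor. 1–2 of Thm. 1 (pp. 173–174); Zarhin 2008 Thm. 3.2 (p. 7; Lenstra–Oort–Zarhin
1996: finiteness of the set of abelian subvarieties); Lange–Rodríguez, *Decomposition of Jacobians by Prym Varieties* (2022) §2.9
(PDF p. 44: the isotypical abelian subvarieties `Σ_j A^{e_{i_j}}`); Milne 1986 §12 Prop. 12.1 (PDF p. 189: `dim`).

Results (namespace `Literature.AlgebraicGeometry.HodgeTheory.AbelianVariety`; perfect field):
* **`setOf_range_subvariety_dim_eq_eq_image`** (the closed subsets of abelian subvarieties of dimension `d` are the partial sums over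
  the `T` with `Σ_{t ∈ T} dim Y_t = d`), **`natCard_setOf_range_subvariety_dim_eq`** (their number is `#{T : Σ_{t ∈ T} dim Y_t = d}`),
  `natCard_setOf_range_subvariety_dim_eq_of_forall_dim_eq_one` (`= (#Q).choose d` when all `dim Y_q = 1`),
  `natCard_setOf_range_subvariety_dim_eq_of_isIsogenous_biproduct_simple` (decomposition-free: `X ∼ ⨁_q B_q`),
  **`natCard_setOf_range_subvariety_dim_eq_of_isIsogenous_biproduct_dim_eq_one`** (a product of `r` pairwise non-isogenous elliptic
  curves, up to isogeny, has exactly `r.choose d` abelian subvarieties of dimension `d`), `natCard_setOf_range_subvariety_dim_eq_zero`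
  (exactly one of dimension `0`).

## References
* [MumfordAV1970] D. Mumford, *Abelian Varieties* (1970), §19 Thm. 1, Cor. 1–2 (pp. 173–174).
* [Zarhin2008HomomorphismsFiniteFields] Yu. G. Zarhin, *Homomorphisms of abelian varieties over finite fields* (2008)
  (arXiv:0711.1615), Thm. 3.2 (p. 7).
* [LangeRodriguez2022] H. Lange, R. E. Rodríguez, LNM 2310 (2022), §2.9 (PDF p. 44).
* [Milne1986AbelianVarieties] J. S. Milne, *Abelian Varieties*, in Cornell–Silverman (1986), §12 Prop. 12.1 (PDF p. 189).
-/

noncomputable section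

universe u

open CategoryTheory CategoryTheory.Limits

namespace Literature.AlgebraicGeometry.HodgeTheory

namespace AbelianVariety

open _root_.AlgebraicGeometry
open Literature.AlgebraicGeometry.Motives Literature.AlgebraicGeometry.Motives.AbelianVariety

variable {K : Type u} [Field K] [PerfectField K] {X : Motives.AbelianVariety K} {Q : Type} [Fintype Q]
  {Y B : Q → Motives.AbelianVariety K}

/-- **THE ABELIAN SUBVARIETIES OF DIMENSION `d` OF A MULTIPLICITY-FREE `X` ARE THE PARTIAL SUMS `Σ_{t ∈ T} Y_t` WITH `Σ_{t ∈ T} dim Y_t = d`**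
(as closed subsets; perfect field). [cite: MumfordAV1970, §19 Cor. 1–2 of Thm. 1 (pp. 173–174)] [cite: LangeRodriguez2022, §2.9 (PDF p. 44)]
[cite: Milne1986AbelianVarieties, §12 Prop. 12.1 (PDF p. 189)] -/
theorem setOf_range_subvariety_dim_eq_eq_image (i : ∀ q, Y q ⟶ X) (hi : ∀ q, IsClosedImmersion (Hom.toSchemeHom (i q)))
    (hdesc : IsIsogeny (biproduct.desc i)) (horth : ∀ q q', q ≠ q' → ∀ f : Y q ⟶ Y q', f = 0)
    (hYs : ∀ q, (Y q).IsSimple) (d : ℕ) :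
    {R : Set X.X.left | ∃ (Z : Motives.AbelianVariety K) (j : Z ⟶ X),
        IsClosedImmersion (Hom.toSchemeHom j) ∧ R = Set.range (Hom.toSchemeHom j) ∧ Z.dim = d} =
      (fun T : Finset Q ↦ Set.range (Hom.toSchemeHom (biproduct.desc fun t : T ↦ i t))) ''
        {T : Finset Q | ∑ t ∈ T, (Y t).dim = d} := by
  ext R
  constructor
  · rintro ⟨Z, j, hj, rfl, hZd⟩
    haveI := hj
    obtain ⟨T, hT⟩ := exists_range_eq_range_biproduct_desc_of_isSimple_of_perfectField i hi hdesc horth hYs j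
    refine ⟨T, ?_, hT.symm⟩
    rw [Set.mem_setOf_eq, ← dim_eq_sum_of_range_eq_range_biproduct_desc i hdesc j T hT, hZd]
  · rintro ⟨T, hT, rfl⟩
    haveI := isFinite_toSchemeHom_biproduct_desc_restrict i hdesc T
    refine ⟨_, imageι (biproduct.desc fun t : T ↦ i t), inferInstance, (range_toSchemeHom_imageι _).symm, ?_⟩
    rw [dim_image_eq_of_isFinite, dim_biproduct, ← (Finset.sum_subtype T (fun _ ↦ Iff.rfl) fun q ↦ (Y q).dim)]
    exact hT

/-- **A MULTIPLICITY-FREE `X` HAS EXACTLY `#{T ⊆ Q : Σ_{t ∈ T} dim Y_t = d}` ABELIAN SUBVARIETIES OF DIMENSION `d`** (components of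
positive dimension; perfect field). [cite: MumfordAV1970, §19 Cor. 1–2 of Thm. 1 (pp. 173–174)] [cite: Zarhin2008HomomorphismsFiniteFields, Thm. 3.2 (p. 7)] -/
theorem natCard_setOf_range_subvariety_dim_eq (i : ∀ q, Y q ⟶ X) (hi : ∀ q, IsClosedImmersion (Hom.toSchemeHom (i q)))
    (hdesc : IsIsogeny (biproduct.desc i)) (horth : ∀ q q', q ≠ q' → ∀ f : Y q ⟶ Y q', f = 0)
    (hYs : ∀ q, (Y q).IsSimple) (hY0 : ∀ q, 0 < (Y q).dim) (d : ℕ) :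
    Nat.card {R : Set X.X.left | ∃ (Z : Motives.AbelianVariety K) (j : Z ⟶ X),
        IsClosedImmersion (Hom.toSchemeHom j) ∧ R = Set.range (Hom.toSchemeHom j) ∧ Z.dim = d} =
      (Finset.univ.filter fun T : Finset Q ↦ ∑ t ∈ T, (Y t).dim = d).card := by
  classical
  obtain ⟨v, m, hm, hdv, hvd⟩ := IsIsogeny.exists_nsmul_inverse_holds hdesc
  rw [setOf_range_subvariety_dim_eq_eq_image i hi hdesc horth hYs d,
    Nat.card_image_of_injective (injective_range_biproduct_desc_components i hi hdv hvd hm.ne' hY0),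
    show Nat.card {T : Finset Q | ∑ t ∈ T, (Y t).dim = d} = Nat.card {T : Finset Q // ∑ t ∈ T, (Y t).dim = d} from rfl,
    Nat.card_eq_fintype_card, Fintype.card_subtype]

/-- **All components elliptic curves: exactly `(#Q).choose d` abelian subvarieties of dimension `d`** (`dim Y_q = 1` for all `q`;
perfect field). [cite: MumfordAV1970, §19 Cor. 1–2 of Thm. 1 (pp. 173–174)] [cite: Zarhin2008HomomorphismsFiniteFields, Thm. 3.2 (p. 7)] -/
theorem natCard_setOf_range_subvariety_dim_eq_of_forall_dim_eq_one (i : ∀ q, Y q ⟶ X)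
    (hi : ∀ q, IsClosedImmersion (Hom.toSchemeHom (i q))) (hdesc : IsIsogeny (biproduct.desc i))
    (horth : ∀ q q', q ≠ q' → ∀ f : Y q ⟶ Y q', f = 0) (hY1 : ∀ q, (Y q).dim = 1) (d : ℕ) :
    Nat.card {R : Set X.X.left | ∃ (Z : Motives.AbelianVariety K) (j : Z ⟶ X),
        IsClosedImmersion (Hom.toSchemeHom j) ∧ R = Set.range (Hom.toSchemeHom j) ∧ Z.dim = d} = (Fintype.card Q).choose d := by
  classical
  rw [natCard_setOf_range_subvariety_dim_eq i hi hdesc horth (fun q ↦ isSimple_of_dim_le_one (hY1 q).le)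
    (fun q ↦ by rw [hY1 q]; exact Nat.one_pos) d]
  have hfilter : (Finset.univ.filter fun T : Finset Q ↦ ∑ t ∈ T, (Y t).dim = d) = Finset.powersetCard d Finset.univ := by
    rw [Finset.powersetCard_eq_filter, Finset.powerset_univ]
    refine Finset.filter_congr fun T _ ↦ ?_
    rw [Finset.sum_congr rfl fun t _ ↦ hY1 t, Finset.sum_const, smul_eq_mul, mul_one]
  rw [hfilter, Finset.card_powersetCard, Finset.card_univ]

/-- There is exactly ONE abelian subvariety of dimension `0` (as a closed subset: the origin) in a multiplicity-free `X` (perfect field).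
[cite: MumfordAV1970, §19 Cor. 1–2 of Thm. 1 (pp. 173–174)] -/
theorem natCard_setOf_range_subvariety_dim_eq_zero (i : ∀ q, Y q ⟶ X) (hi : ∀ q, IsClosedImmersion (Hom.toSchemeHom (i q)))
    (hdesc : IsIsogeny (biproduct.desc i)) (horth : ∀ q q', q ≠ q' → ∀ f : Y q ⟶ Y q', f = 0)
    (hYs : ∀ q, (Y q).IsSimple) (hY0 : ∀ q, 0 < (Y q).dim) :
    Nat.card {R : Set X.X.left | ∃ (Z : Motives.AbelianVariety K) (j : Z ⟶ X),
        IsClosedImmersion (Hom.toSchemeHom j) ∧ R = Set.range (Hom.toSchemeHom j) ∧ Z.dim = 0} = 1 := by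
  classical
  rw [natCard_setOf_range_subvariety_dim_eq i hi hdesc horth hYs hY0 0]
  have hfilter : (Finset.univ.filter fun T : Finset Q ↦ ∑ t ∈ T, (Y t).dim = 0) = {∅} := by
    ext T
    simp only [Finset.mem_filter, Finset.mem_univ, true_and, Finset.mem_singleton,
      Finset.sum_eq_zero_iff]
    constructor
    · intro h
      exact Finset.eq_empty_of_forall_notMem fun t ht ↦ (hY0 t).ne' (h t ht)
    · rintro rfl t ht
      exact absurd ht (Finset.notMem_empty t)
  rw [hfilter, Finset.card_singleton]

variable {B : Q → Motives.AbelianVariety K}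

/-- Decomposition-free form: **`X ∼ ⨁_q B_q` with pairwise non-isogenous simple `B_q` of positive dimension has exactly
`#{T ⊆ Q : Σ_{t ∈ T} dim B_t = d}` abelian subvarieties of dimension `d`** (perfect field).
[cite: MumfordAV1970, §19 Cor. 1–2 of Thm. 1 (pp. 173–174)] [cite: Zarhin2008HomomorphismsFiniteFields, Thm. 3.2 (p. 7)] -/
theorem natCard_setOf_range_subvariety_dim_eq_of_isIsogenous_biproduct_simple (hB : ∀ q, (B q).IsSimple)
    (hB0 : ∀ q, 0 < (B q).dim) (hni : ∀ q q', q ≠ q' → ¬ IsIsogenous (B q) (B q')) (hX : IsIsogenous X (⨁ B)) (d : ℕ) :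
    Nat.card {R : Set X.X.left | ∃ (Z : Motives.AbelianVariety K) (j : Z ⟶ X),
        IsClosedImmersion (Hom.toSchemeHom j) ∧ R = Set.range (Hom.toSchemeHom j) ∧ Z.dim = d} =
      (Finset.univ.filter fun T : Finset Q ↦ ∑ t ∈ T, (B t).dim = d).card := by
  classical
  obtain ⟨Y, i, hi, hY, hd, hdesc⟩ := exists_isClosedImmersion_isIsogeny_biproduct_desc hX
  have hYs : ∀ q, (Y q).IsSimple := fun q ↦ (hY q).isSimple_symm (hB q)
  have hY0 : ∀ q, 0 < (Y q).dim := fun q ↦ by rw [hd q]; exact hB0 q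
  have horth : ∀ q q', q ≠ q' → ∀ f : Y q ⟶ Y q', f = 0 := fun q q' hqq' f ↦
    hom_eq_zero_of_isSimple_of_not_isIsogenous_of_perfectField (hYs q) (hYs q')
      (fun h ↦ hni q q' hqq' (((hY q).symm'.trans h).trans (hY q'))) f
  rw [natCard_setOf_range_subvariety_dim_eq i hi hdesc horth hYs hY0 d]
  congr 1
  refine Finset.filter_congr fun T _ ↦ ?_
  rw [Finset.sum_congr rfl fun t _ ↦ hd t]

/-- **A PRODUCT OF `r` PAIRWISE NON-ISOGENOUS ELLIPTIC CURVES HAS EXACTLY `r.choose d` ABELIAN SUBVARIETIES OF DIMENSION `d`** (for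
`X ∼ ⨁_q E_q`, `dim E_q = 1`, `E_q ≁ E_{q'}`; perfect field) — the partial products `∏_{t ∈ T} E_t`, `#T = d`.
[cite: MumfordAV1970, §19 Cor. 1–2 of Thm. 1 (pp. 173–174)] [cite: Zarhin2008HomomorphismsFiniteFields, Thm. 3.2 (p. 7)] -/
theorem natCard_setOf_range_subvariety_dim_eq_of_isIsogenous_biproduct_dim_eq_one (hB1 : ∀ q, (B q).dim = 1)
    (hni : ∀ q q', q ≠ q' → ¬ IsIsogenous (B q) (B q')) (hX : IsIsogenous X (⨁ B)) (d : ℕ) :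
    Nat.card {R : Set X.X.left | ∃ (Z : Motives.AbelianVariety K) (j : Z ⟶ X),
        IsClosedImmersion (Hom.toSchemeHom j) ∧ R = Set.range (Hom.toSchemeHom j) ∧ Z.dim = d} = (Fintype.card Q).choose d := by
  classical
  obtain ⟨Y, i, hi, hY, hd, hdesc⟩ := exists_isClosedImmersion_isIsogeny_biproduct_desc hX
  have hY1 : ∀ q, (Y q).dim = 1 := fun q ↦ (hd q).trans (hB1 q)
  have hYs : ∀ q, (Y q).IsSimple := fun q ↦ isSimple_of_dim_le_one (hY1 q).le
  have horth : ∀ q q', q ≠ q' → ∀ f : Y q ⟶ Y q', f = 0 := fun q q' hqq' f ↦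
    hom_eq_zero_of_isSimple_of_not_isIsogenous_of_perfectField (hYs q) (hYs q')
      (fun h ↦ hni q q' hqq' (((hY q).symm'.trans h).trans (hY q'))) f
  exact natCard_setOf_range_subvariety_dim_eq_of_forall_dim_eq_one i hi hdesc horth hY1 d

end AbelianVariety

end Literature.AlgebraicGeometry.HodgeTheory

end
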